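import Summits.QuantumFields.YangMills.Theorems.BalabanUVNodesN07SymTauScheduleNumerics
import HarnessLib

/-!
# N07 [B11] (= [15] = [Balaban1985Variational]) Sect. F ∕ [I] (0.4), (0.11) — MODULE 139 (ASK-7 of the φ-junction, director-ym №330): **ALL NUMERIC BINDERS OF THE PER-CELL ROW 9′
# (dag-n07-w3 ✓p760822 `torusRow_at_recordCube_cell`) AND OF MODULE 138's `hvfix` SUPPLIER, FROM ONE FINE LETTER `a₀` AND THE (σ1) CONSTANT `ω_u`** — the schedule
# `a(n) := 240·E₂(n)`, `ω_τ := 3840·Ω₀`, `θ := L⁻¹` (dag-n07-w3 ✓p758613 `schedule_of_fineLetter` BY NAME) plus the cell lemma's own rows (`θ ≤ 1∕8`, `ω_τ + ω_u ≤ 1∕512`,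
# `4096·θ·(ω_τ + ω_u) ≤ 1`, the guard row `hguardN` at EVERY pair of exponents) plus MODULE 137∕138's three two-block rows, under SEVEN displayed smallness conditions (+ `2 ≤ d`, `8 ≤ L`)

Cell `pub-ymgap`, seat `pub-ymgap-dag-n07-e` g33 (FAN-OUT §N07 row s3; LANE OWNER of the K0 road chart side).  `--kind proof --supports stmt-QuantumFields-20541 --as helper` (K0⁷;
count-neutral).  THEOREMS ONLY (0 `def`); generic `P` with `2 ≤ d`, `8 ≤ L`.  [I] = [Balaban1987RG1]; [15] = [Balaban1985Variational]; [6] = [Balaban1985RegularSpaces].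
Elementary real arithmetic; `deltaSU (Fin N)` (`ExpMeanLog`) and `(FederbushMean.federbushSU).δ` enter only as right-hand sides of displayed smallness conditions.

WHY.  The junction's closing file `hJ` calls ✓p760822 per cell; its numeric binders are (i) ✓p755647's per-level rows `hbud ∕ hgd ∕ haa ∕ h100 ∕ hguard` and the geometric schedule `hE`
for a letter schedule `a` — supplied by ✓p758613 from `a₀` — (ii) the cell lemma's `0 ≤ θ ≤ 1∕8`, `ω_τ + ω_u ≤ 1∕512`, `4096θ(ω_τ + ω_u) ≤ 1` (+ the junction's `4ω_τ < δ_N`, dag-n07-w3 INTENT-34), and (iii) the guard row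
`hguardN : 4ω_τθ^{j′−(i+1)} + 4ω_uθ^{j′−(i+1)} + 2·(1024·(4(ω_τ+ω_u)θ^{j′−i}))² < δ_N`; MODULE 138 adds (iv) three two-block rows per level (`s₂(i) = (d−1)(2L^{i+1}−1)a₀`).  With
`θ := L⁻¹` and `L ≥ 8`, (ii) reduces to `ω_τ + ω_u ≤ 1∕512`; (iii) follows at every pair of exponents from `65540·(ω_τ + ω_u) < δ_N` (`θ ≤ 1`, `(4096 S)² ≤ 32768·S` for `S ≤ 1∕512`);
(iv) are monomials `≤ 12800·Ω₁`, `≤ 60·Ω₁`, `≤ 960·Ω₂` (`Ω₁ := (d+2)²(d−1)L^{2k+2}a₀`, `Ω₂ := d(d+2)³(d−1)L^{2k+3}a₀`; crude bounds `2L^{i+1} − 1 ≤ 2L^{i+1}`, `4(d−1)(2L−1) + 1 ≤ 8dL`,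
`i + 1 ≤ k`).  With `a₀ = O(ε·L^{−2k})` every condition is `O(L⁵·ε)`-small.  NO estimate of [I]∕[15]∕[6].

WHAT IS PROVED (sorry-free).
§1 crude bounds: `cast_two_pow_sub_one_le`, `four_d_two_L_le`, ★ `twoBlock_bud_le`, ★ `twoBlock_gd_le`, ★ `twoBlock_sm_le`, ★ `guardN_le` (`≤ 65540·(ω_τ+ω_u)`), `inv_L_le_eighth`.
§2 ★★★ `numerics_of_fineLetter` — for `2 ≤ d`, `8 ≤ L`, `0 < a₀`, `0 ≤ ω_u` and the nine conditions `48000Ω₀ ≤ 1`, `480Ω₀ < δ_Fed`, `12800Ω₁ ≤ 1`, `60Ω₁ < δ_N`, `960Ω₂ < δ_N`,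
   `3840Ω₀ + ω_u ≤ 1∕512`, `65540(3840Ω₀ + ω_u) < δ_N` (`Ω₀ := d(d+2)(d−1)²L^{2k+2}a₀`): `∃ a ω_τ`, `ω_τ = 3840Ω₀`, and ALL of (i)–(iv) VERBATIM in ✓p760822's ∕ MODULE 138's shapes
   at `θ := (L : ℝ)⁻¹`, cube level `k` (the guard row for EVERY `j′ i`).  §3 `L_lt_sitesPerDir_of_three_le` (✓p760822's `hN` row from `3 ≤ sitesPerDir k`).
§4 `eight_le_L_record` (the record meets `8 ≤ L`: `L > 11`; `2 ≤ d` is ✓`…K0Stub1H128OfRecordCriticalityLetter.two_le_d_T4`).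
§5 (v1.1, ref-G READ627 NIT-1) `guardN_shape_of_strong`, ★ `hguardN_of_numerics` (§2's clause (iii) ⇒ ✓p760822's `hguardN` in its EXACT shape `2·(1024·X²)`), `hguardN_of_row15` (the same from the
   junction's row n15 `4S + 32768S² < δ_N`).  NIT-1: §2's (iii) is the STRONGER `2·(1024·X)²` form — NOT byte-verbatim; feed it through `hguardN_of_numerics`.
HONEST FRAMING: count-neutral helper; elementary arithmetic — nothing of [I]∕[15]∕[6] asserted or discharged; `a₀`, `ω_u` and the nine conditions remain DISPLAYED (the knit's (17) letter
`a₀ = ε_{j−1}·η_{j−1}²` and the (σ1) constant); `hJ` ∕ `DatumCrownPhiAt` ∕ `hsup` ∕ HSEAM inhabited by nobody; `HThm4RecSym152PhiEG` ∕ `HThm4Rec*` UNDISCHARGED; N05 ∕ N07 NOT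
discharged; K0⁷ ∕ K1⁹ NOT closed; counts unmoved (typed 28∕28 · discharged 8∕28); R4 closes the conditional finite-𝕋⁴ rung `BalabanLadder.UV` only; the YM mass gap (Clay) is NOT proved
by any of this; nothing continuum ∕ ℝ⁴ ∕ OS.  No `def`, no `instance`, no `notation`, no `sorry`.

References: [I] (0.4) p. 253, (0.11) p. 253; [15] (147)–(154) pp. 301–302; [6] (1.15) p. 78, Lemma 1 p. 79.
-/

set_option autoImplicit false

noncomputable section

namespace Summit.QuantumFields.YangMills.BalabanUVNodes.N07SymPhiCellNumericsOfFineLetter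

open Literature.MathematicalPhysics.QuantumFieldTheory.Balaban1983to89
open ExpMeanLog (deltaSU)
open Summit.QuantumFields.YangMills.BalabanUVNodes.N07SymTauScheduleNumerics (schedule_of_fineLetter one_le_cast_pow_sub_one)

variable {P : Params}

/-! ## §1  Crude bounds -/

/-- `((2L^{m} − 1 : ℕ) : ℝ) ≤ 2L^{m}`. [folklore] -/
theorem cast_two_pow_sub_one_le (m : ℕ) : (((2 * P.L ^ m - 1 : ℕ) : ℝ)) ≤ 2 * (P.L : ℝ) ^ m := by
  have h : ((2 * P.L ^ m - 1 : ℕ) : ℝ) ≤ ((2 * P.L ^ m : ℕ) : ℝ) := by exact_mod_cast Nat.sub_le _ _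
  simpa using h

/-- `4(d−1)(2L−1) + 1 ≤ 8dL` (`1 ≤ d`, `1 ≤ L`), in the real casts of MODULE 70. [folklore] -/
theorem four_d_two_L_le (hd : 1 ≤ P.d) : 4 * ((((P.d - 1 : ℕ) : ℝ)) * ((2 * P.L - 1 : ℕ) : ℝ)) + 1 ≤ 8 * (P.d : ℝ) * (P.L : ℝ) := by
  have hL : 1 ≤ P.L := P.L_pos
  have h1 : ((P.d - 1 : ℕ) : ℝ) = (P.d : ℝ) - 1 := by push_cast [Nat.cast_sub hd]; ring
  have h2 : ((2 * P.L - 1 : ℕ) : ℝ) = 2 * (P.L : ℝ) - 1 := by push_cast [Nat.cast_sub (show 1 ≤ 2 * P.L by omega)]; ring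
  have hd' : (1 : ℝ) ≤ P.d := by exact_mod_cast hd
  have hL' : (1 : ℝ) ≤ P.L := by exact_mod_cast hL
  rw [h1, h2]
  nlinarith

/-- ★ The two-block budget row of MODULES 137∕138 is a monomial: `6400ℓ²L^{i+1}s₂(i) ≤ 12800·Ω₁` for `i + 1 ≤ k` (`Ω₁ := (d+2)²(d−1)L^{2k+2}a₀`). [cite: Balaban1987RG1, (0.11) p.253 (bookkeeping)] -/
theorem twoBlock_bud_le {k i : ℕ} (hi : i + 1 ≤ k) {a₀ : ℝ} (ha₀ : 0 ≤ a₀) :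
    6400 * (((P.d + 2) * P.L : ℕ) : ℝ) ^ 2 * (P.L : ℝ) ^ (i + 1) * ((((P.d - 1 : ℕ) : ℝ)) * (((2 * P.L ^ (i + 1) - 1 : ℕ) : ℝ)) * a₀) ≤
      12800 * (((P.d : ℝ) + 2) ^ 2 * ((P.d - 1 : ℕ) : ℝ) * (P.L : ℝ) ^ (2 * k + 2) * a₀) := by
  have hL1 : (1 : ℝ) ≤ P.L := by exact_mod_cast P.L_pos
  have hD0 : (0 : ℝ) ≤ ((P.d - 1 : ℕ) : ℝ) := Nat.cast_nonneg _
  have hT := cast_two_pow_sub_one_le (P := P) (i + 1)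
  have hT0 : (0 : ℝ) ≤ (((2 * P.L ^ (i + 1) - 1 : ℕ) : ℝ)) := Nat.cast_nonneg _
  have hc : (((P.d + 2) * P.L : ℕ) : ℝ) = ((P.d : ℝ) + 2) * P.L := by push_cast; ring
  have hpow : (P.L : ℝ) ^ 2 * (P.L : ℝ) ^ (i + 1) * (P.L : ℝ) ^ (i + 1) ≤ (P.L : ℝ) ^ (2 * k + 2) := by
    rw [← pow_add, ← pow_add]; exact pow_le_pow_right₀ hL1 (by omega)
  rw [hc]
  calc 6400 * (((P.d : ℝ) + 2) * P.L) ^ 2 * (P.L : ℝ) ^ (i + 1) * ((((P.d - 1 : ℕ) : ℝ)) * (((2 * P.L ^ (i + 1) - 1 : ℕ) : ℝ)) * a₀)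
      ≤ 6400 * (((P.d : ℝ) + 2) * P.L) ^ 2 * (P.L : ℝ) ^ (i + 1) * ((((P.d - 1 : ℕ) : ℝ)) * (2 * (P.L : ℝ) ^ (i + 1)) * a₀) := by
        apply mul_le_mul_of_nonneg_left _ (by positivity)
        exact mul_le_mul_of_nonneg_right (mul_le_mul_of_nonneg_left hT hD0) ha₀
    _ = 12800 * (((P.d : ℝ) + 2) ^ 2 * ((P.d - 1 : ℕ) : ℝ) * a₀) * ((P.L : ℝ) ^ 2 * (P.L : ℝ) ^ (i + 1) * (P.L : ℝ) ^ (i + 1)) := by ring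
    _ ≤ 12800 * (((P.d : ℝ) + 2) ^ 2 * ((P.d - 1 : ℕ) : ℝ) * a₀) * (P.L : ℝ) ^ (2 * k + 2) := mul_le_mul_of_nonneg_left hpow (by positivity)
    _ = 12800 * (((P.d : ℝ) + 2) ^ 2 * ((P.d - 1 : ℕ) : ℝ) * (P.L : ℝ) ^ (2 * k + 2) * a₀) := by ring

/-- ★ The two-block guard row is a monomial: `30ℓ²L^{i+1}s₂(i) ≤ 60·Ω₁` for `i + 1 ≤ k`. [cite: Balaban1987RG1, (0.4) p.253 (bookkeeping)] -/
theorem twoBlock_gd_le {k i : ℕ} (hi : i + 1 ≤ k) {a₀ : ℝ} (ha₀ : 0 ≤ a₀) :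
    30 * (((P.d + 2) * P.L : ℕ) : ℝ) ^ 2 * (P.L : ℝ) ^ (i + 1) * ((((P.d - 1 : ℕ) : ℝ)) * (((2 * P.L ^ (i + 1) - 1 : ℕ) : ℝ)) * a₀) ≤
      60 * (((P.d : ℝ) + 2) ^ 2 * ((P.d - 1 : ℕ) : ℝ) * (P.L : ℝ) ^ (2 * k + 2) * a₀) := by
  have h := twoBlock_bud_le (P := P) hi ha₀
  have h0 : (0 : ℝ) ≤ (((P.d + 2) * P.L : ℕ) : ℝ) ^ 2 * (P.L : ℝ) ^ (i + 1) * ((((P.d - 1 : ℕ) : ℝ)) * (((2 * P.L ^ (i + 1) - 1 : ℕ) : ℝ)) * a₀) := by positivity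
  nlinarith

/-- ★ MODULE 70's (0.4) row at the letter `240ℓLⁱs₂(i)` is a monomial: `(ℓ²∕4)·(4(d−1)(2L−1)+1)·(240ℓLⁱs₂(i)) ≤ 960·Ω₂` for `i + 1 ≤ k`, `1 ≤ d` (`Ω₂ := d(d+2)³(d−1)L^{2k+3}a₀`).
[cite: Balaban1987RG1, (0.4) p.253 (bookkeeping)] -/
theorem twoBlock_sm_le (hd : 1 ≤ P.d) {k i : ℕ} (hi : i + 1 ≤ k) {a₀ : ℝ} (ha₀ : 0 ≤ a₀) :
    ((((P.d + 2) * P.L : ℕ) : ℝ) ^ 2 / 4) * ((4 * ((((P.d - 1 : ℕ) : ℝ)) * ((2 * P.L - 1 : ℕ) : ℝ)) + 1) *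
      (240 * (((P.d + 2) * P.L : ℕ) : ℝ) * (P.L : ℝ) ^ i * ((((P.d - 1 : ℕ) : ℝ)) * (((2 * P.L ^ (i + 1) - 1 : ℕ) : ℝ)) * a₀))) ≤
      960 * ((P.d : ℝ) * ((P.d : ℝ) + 2) ^ 3 * ((P.d - 1 : ℕ) : ℝ) * (P.L : ℝ) ^ (2 * k + 3) * a₀) := by
  have hL1 : (1 : ℝ) ≤ P.L := by exact_mod_cast P.L_pos
  have hD0 : (0 : ℝ) ≤ ((P.d - 1 : ℕ) : ℝ) := Nat.cast_nonneg _
  have hT := cast_two_pow_sub_one_le (P := P) (i + 1)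
  have hT0 : (0 : ℝ) ≤ (((2 * P.L ^ (i + 1) - 1 : ℕ) : ℝ)) := Nat.cast_nonneg _
  have hF := four_d_two_L_le (P := P) hd
  have hF0 : (0 : ℝ) ≤ 4 * ((((P.d - 1 : ℕ) : ℝ)) * ((2 * P.L - 1 : ℕ) : ℝ)) + 1 := by positivity
  have hc : (((P.d + 2) * P.L : ℕ) : ℝ) = ((P.d : ℝ) + 2) * P.L := by push_cast; ring
  have hpow : (P.L : ℝ) ^ 2 * (P.L : ℝ) * ((P.L : ℝ) * (P.L : ℝ) ^ i * (P.L : ℝ) ^ (i + 1)) ≤ (P.L : ℝ) ^ (2 * k + 3) := by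
    have : (P.L : ℝ) ^ 2 * (P.L : ℝ) * ((P.L : ℝ) * (P.L : ℝ) ^ i * (P.L : ℝ) ^ (i + 1)) = (P.L : ℝ) ^ (2 * i + 5) := by ring
    rw [this]; exact pow_le_pow_right₀ hL1 (by omega)
  rw [hc]
  calc ((((P.d : ℝ) + 2) * P.L) ^ 2 / 4) * ((4 * ((((P.d - 1 : ℕ) : ℝ)) * ((2 * P.L - 1 : ℕ) : ℝ)) + 1) *
        (240 * (((P.d : ℝ) + 2) * P.L) * (P.L : ℝ) ^ i * ((((P.d - 1 : ℕ) : ℝ)) * (((2 * P.L ^ (i + 1) - 1 : ℕ) : ℝ)) * a₀)))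
      ≤ ((((P.d : ℝ) + 2) * P.L) ^ 2 / 4) * ((8 * (P.d : ℝ) * (P.L : ℝ)) *
        (240 * (((P.d : ℝ) + 2) * P.L) * (P.L : ℝ) ^ i * ((((P.d - 1 : ℕ) : ℝ)) * (2 * (P.L : ℝ) ^ (i + 1)) * a₀))) := by
        apply mul_le_mul_of_nonneg_left _ (by positivity)
        apply mul_le_mul hF _ (by positivity) (by positivity)
        apply mul_le_mul_of_nonneg_left _ (by positivity)
        exact mul_le_mul_of_nonneg_right (mul_le_mul_of_nonneg_left hT hD0) ha₀
    _ = 960 * ((P.d : ℝ) * ((P.d : ℝ) + 2) ^ 3 * ((P.d - 1 : ℕ) : ℝ) * a₀) * ((P.L : ℝ) ^ 2 * (P.L : ℝ) * ((P.L : ℝ) * (P.L : ℝ) ^ i * (P.L : ℝ) ^ (i + 1))) := by ring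
    _ ≤ 960 * ((P.d : ℝ) * ((P.d : ℝ) + 2) ^ 3 * ((P.d - 1 : ℕ) : ℝ) * a₀) * (P.L : ℝ) ^ (2 * k + 3) := mul_le_mul_of_nonneg_left hpow (by positivity)
    _ = 960 * ((P.d : ℝ) * ((P.d : ℝ) + 2) ^ 3 * ((P.d - 1 : ℕ) : ℝ) * (P.L : ℝ) ^ (2 * k + 3) * a₀) := by ring

/-- ★ The guard row of ✓p760822 at ANY pair of exponents: for `0 ≤ θ ≤ 1`, `0 ≤ ω_τ, ω_u`, `ω_τ + ω_u ≤ 1∕512`: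
`4ω_τθ^a + 4ω_uθ^a + 2·(1024·(4(ω_τ+ω_u)θ^b))² ≤ 65540·(ω_τ + ω_u)`. [cite: Balaban1987RG1, (0.4) p.253 (bookkeeping)] -/
theorem guardN_le {θ ωτ ωu : ℝ} (hθ0 : 0 ≤ θ) (hθ1 : θ ≤ 1) (hωτ : 0 ≤ ωτ) (hωu : 0 ≤ ωu) (hω : ωτ + ωu ≤ 1 / 512) (a b : ℕ) :
    4 * ωτ * θ ^ a + 4 * ωu * θ ^ a + 2 * (1024 * (4 * (ωτ + ωu) * θ ^ b)) ^ 2 ≤ 65540 * (ωτ + ωu) := by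
  have ha1 : θ ^ a ≤ 1 := pow_le_one₀ hθ0 hθ1
  have hb1 : θ ^ b ≤ 1 := pow_le_one₀ hθ0 hθ1
  have ha0 : 0 ≤ θ ^ a := pow_nonneg hθ0 _
  have hb0 : 0 ≤ θ ^ b := pow_nonneg hθ0 _
  have hS0 : 0 ≤ ωτ + ωu := by positivity
  have h1 : 4 * ωτ * θ ^ a ≤ 4 * ωτ := by nlinarith
  have h2 : 4 * ωu * θ ^ a ≤ 4 * ωu := by nlinarith
  have h3 : (1024 * (4 * (ωτ + ωu) * θ ^ b)) ^ 2 ≤ (4096 * (ωτ + ωu)) ^ 2 := by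
    have hx0 : 0 ≤ 1024 * (4 * (ωτ + ωu) * θ ^ b) := by positivity
    have hx : 1024 * (4 * (ωτ + ωu) * θ ^ b) ≤ 4096 * (ωτ + ωu) := by nlinarith
    exact pow_le_pow_left₀ hx0 hx 2
  have h4 : (4096 * (ωτ + ωu)) ^ 2 ≤ 32768 * (ωτ + ωu) := by nlinarith
  linarith

/-- `θ := L⁻¹ ≤ 1∕8` for `8 ≤ L`. [folklore] -/
theorem inv_L_le_eighth (hL8 : 8 ≤ P.L) : (P.L : ℝ)⁻¹ ≤ 1 / 8 := by
  have h : (8 : ℝ) ≤ P.L := by exact_mod_cast hL8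
  rw [inv_eq_one_div]
  exact one_div_le_one_div_of_le (by norm_num) h

/-! ## §2  The numerics of the per-cell row 9′ and of MODULE 138, from `a₀` and `ω_u` -/

/-- ★★★ **ASK-7 — ALL NUMERIC BINDERS OF ✓p760822 `torusRow_at_recordCube_cell` (cube level `k`, `θ := L⁻¹`, guard row at every pair of exponents) AND MODULE 138's THREE
TWO-BLOCK ROWS, FROM ONE FINE LETTER `a₀ > 0` AND THE (σ1) CONSTANT `ω_u ≥ 0`** under nine displayed smallness conditions (`Ω₀ := d(d+2)(d−1)²L^{2k+2}a₀`, `Ω₁ := (d+2)²(d−1)L^{2k+2}a₀`,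
`Ω₂ := d(d+2)³(d−1)L^{2k+3}a₀`, all spelled out): `48000Ω₀ ≤ 1`, `480Ω₀ < δ_Fed`, `12800Ω₁ ≤ 1`, `60Ω₁ < δ_N`, `960Ω₂ < δ_N`, `3840Ω₀ + ω_u ≤ 1∕512`, `65540(3840Ω₀ + ω_u) < δ_N`;
`2 ≤ d`, `8 ≤ L`.  Witnesses: `a(n) := 240·E₂(n)` and `ω_τ := 3840Ω₀` (✓p758613 `schedule_of_fineLetter`).
[cite: Balaban1987RG1, (0.4) p.253, (0.11) p.253; Balaban1985Variational, (147)–(154) pp.301–302; Balaban1985RegularSpaces, (1.15) p.78, Lemma 1 p.79] -/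
theorem numerics_of_fineLetter (N : ℕ) [NeZero N] (hd : 2 ≤ P.d) (hL8 : 8 ≤ P.L) (k : ℕ) {a₀ ωu : ℝ} (ha₀ : 0 < a₀) (hωu : 0 ≤ ωu)
    (h100 : 48000 * ((P.d : ℝ) * ((P.d : ℝ) + 2) * ((P.d - 1 : ℕ) : ℝ) ^ 2 * (P.L : ℝ) ^ (2 * k + 2) * a₀) ≤ 1)
    (hFed : 480 * ((P.d : ℝ) * ((P.d : ℝ) + 2) * ((P.d - 1 : ℕ) : ℝ) ^ 2 * (P.L : ℝ) ^ (2 * k + 2) * a₀) < (FederbushMean.federbushSU (n := Fin N)).δ)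
    (hbud : 12800 * (((P.d : ℝ) + 2) ^ 2 * ((P.d - 1 : ℕ) : ℝ) * (P.L : ℝ) ^ (2 * k + 2) * a₀) ≤ 1)
    (hgd : 60 * (((P.d : ℝ) + 2) ^ 2 * ((P.d - 1 : ℕ) : ℝ) * (P.L : ℝ) ^ (2 * k + 2) * a₀) < deltaSU (Fin N))
    (hsm : 960 * ((P.d : ℝ) * ((P.d : ℝ) + 2) ^ 3 * ((P.d - 1 : ℕ) : ℝ) * (P.L : ℝ) ^ (2 * k + 3) * a₀) < deltaSU (Fin N))
    (h512 : 3840 * ((P.d : ℝ) * ((P.d : ℝ) + 2) * ((P.d - 1 : ℕ) : ℝ) ^ 2 * (P.L : ℝ) ^ (2 * k + 2) * a₀) + ωu ≤ 1 / 512)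
    (hgN : 65540 * (3840 * ((P.d : ℝ) * ((P.d : ℝ) + 2) * ((P.d - 1 : ℕ) : ℝ) ^ 2 * (P.L : ℝ) ^ (2 * k + 2) * a₀) + ωu) < deltaSU (Fin N)) :
    ∃ (a : ℕ → ℝ) (ωτ : ℝ),
      ωτ = 3840 * ((P.d : ℝ) * ((P.d : ℝ) + 2) * ((P.d - 1 : ℕ) : ℝ) ^ 2 * (P.L : ℝ) ^ (2 * k + 2) * a₀) ∧ 0 ≤ ωτ ∧ (∀ n, 0 ≤ a n) ∧
      -- (i) ✓p755647 ∕ ✓p760822 per-level rows at the schedule `a`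
      (∀ n, n < k → 6400 * (((P.d + 2) * P.L : ℕ) : ℝ) ^ 2 * (P.L : ℝ) ^ (n + 1) * ((((P.d - 1 : ℕ) : ℝ)) * (((P.L ^ (n + 1) - 1 : ℕ) : ℝ)) * a₀) ≤ 1) ∧
      (∀ n, n < k → 30 * (((P.d + 2) * P.L : ℕ) : ℝ) ^ 2 * (P.L : ℝ) ^ (n + 1) * ((((P.d - 1 : ℕ) : ℝ)) * (((P.L ^ (n + 1) - 1 : ℕ) : ℝ)) * a₀) < deltaSU (Fin N)) ∧
      (∀ n, n < k → 120 * (((P.d + 2) * P.L : ℕ) : ℝ) * (P.L : ℝ) ^ n * ((((P.d - 1 : ℕ) : ℝ)) * (((P.L ^ (n + 1) - 1 : ℕ) : ℝ)) * a₀) < a n) ∧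
      (∀ n, n < k → 2 * (((P.d * ((P.L - 1) / 2) : ℕ) : ℝ) * ((((P.d - 1 : ℕ) : ℝ) * ((P.L - 1 : ℕ) : ℝ)) * a n)) ≤ 1 / 100) ∧
      (∀ n, n < k → 2 * (((P.d * ((P.L - 1) / 2) : ℕ) : ℝ) * ((((P.d - 1 : ℕ) : ℝ) * ((P.L - 1 : ℕ) : ℝ)) * a n)) < (FederbushMean.federbushSU (n := Fin N)).δ) ∧
      (∀ m, m < k → 4 * (2 * (((P.d * ((P.L - 1) / 2) : ℕ) : ℝ) * ((((P.d - 1 : ℕ) : ℝ) * ((P.L - 1 : ℕ) : ℝ)) * a m))) ≤ ωτ / 2 * ((P.L : ℝ)⁻¹) ^ (k - (m + 1))) ∧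
      -- (ii) the cell lemma's own rows at `θ := L⁻¹`
      0 ≤ (P.L : ℝ)⁻¹ ∧ (P.L : ℝ)⁻¹ ≤ 1 / 8 ∧ ωτ + ωu ≤ 1 / 512 ∧ 4096 * (P.L : ℝ)⁻¹ * (ωτ + ωu) ≤ 1 ∧ 4 * ωτ < deltaSU (Fin N) ∧
      -- (iii) the guard row `hguardN`, at every pair of exponents
      (∀ j i : ℕ, 4 * ωτ * ((P.L : ℝ)⁻¹) ^ (j - (i + 1)) + 4 * ωu * ((P.L : ℝ)⁻¹) ^ (j - (i + 1)) +
        2 * (1024 * (4 * (ωτ + ωu) * ((P.L : ℝ)⁻¹) ^ (j - i))) ^ 2 < deltaSU (Fin N)) ∧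
      -- (iv) MODULE 137 ∕ 138's two-block rows
      (∀ i, i < k → 6400 * (((P.d + 2) * P.L : ℕ) : ℝ) ^ 2 * (P.L : ℝ) ^ (i + 1) * ((((P.d - 1 : ℕ) : ℝ)) * (((2 * P.L ^ (i + 1) - 1 : ℕ) : ℝ)) * a₀) ≤ 1) ∧
      (∀ i, i < k → 30 * (((P.d + 2) * P.L : ℕ) : ℝ) ^ 2 * (P.L : ℝ) ^ (i + 1) * ((((P.d - 1 : ℕ) : ℝ)) * (((2 * P.L ^ (i + 1) - 1 : ℕ) : ℝ)) * a₀) < deltaSU (Fin N)) ∧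
      (∀ i, i < k → ((((P.d + 2) * P.L : ℕ) : ℝ) ^ 2 / 4) * ((4 * ((((P.d - 1 : ℕ) : ℝ)) * ((2 * P.L - 1 : ℕ) : ℝ)) + 1) *
        (240 * (((P.d + 2) * P.L : ℕ) : ℝ) * (P.L : ℝ) ^ i * ((((P.d - 1 : ℕ) : ℝ)) * (((2 * P.L ^ (i + 1) - 1 : ℕ) : ℝ)) * a₀))) < deltaSU (Fin N)) := by
  have hL2 : 2 ≤ P.L := le_trans (by norm_num) hL8
  have hd1 : 1 ≤ P.d := le_trans (by norm_num) hd
  have hL1 : (1 : ℝ) ≤ P.L := by exact_mod_cast P.L_pos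
  have hD1 : (1 : ℝ) ≤ ((P.d - 1 : ℕ) : ℝ) := by exact_mod_cast (show 1 ≤ P.d - 1 by omega)
  -- the four conditions of ✓p758613 follow from ours
  have hbud' : 6400 * (((P.d : ℝ) + 2) ^ 2 * ((P.d - 1 : ℕ) : ℝ) * (P.L : ℝ) ^ (2 * k + 2) * a₀) ≤ 1 := by
    have : (0 : ℝ) ≤ ((P.d : ℝ) + 2) ^ 2 * ((P.d - 1 : ℕ) : ℝ) * (P.L : ℝ) ^ (2 * k + 2) * a₀ := by positivity
    linarith
  have hgd' : 30 * (((P.d : ℝ) + 2) ^ 2 * ((P.d - 1 : ℕ) : ℝ) * (P.L : ℝ) ^ (2 * k + 2) * a₀) < deltaSU (Fin N) := by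
    have : (0 : ℝ) ≤ ((P.d : ℝ) + 2) ^ 2 * ((P.d - 1 : ℕ) : ℝ) * (P.L : ℝ) ^ (2 * k + 2) * a₀ := by positivity
    linarith
  obtain ⟨_, ωτ, hωτ, hωτ0, -, hb, hg, -, h1, h2, hE⟩ := schedule_of_fineLetter N hd hL2 k ha₀ h100 hFed hbud' hgd'
  have hE2pos : ∀ n : ℕ, 0 < (((P.d + 2) * P.L : ℕ) : ℝ) * (P.L : ℝ) ^ n * ((((P.d - 1 : ℕ) : ℝ)) * (((P.L ^ (n + 1) - 1 : ℕ) : ℝ)) * a₀) := by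
    intro n
    have ha : (0 : ℝ) < (((P.d + 2) * P.L : ℕ) : ℝ) := by
      have : 0 < (P.d + 2) * P.L := Nat.mul_pos (by omega) P.L_pos
      exact_mod_cast this
    have hb0 : (0 : ℝ) < (((P.L ^ (n + 1) - 1 : ℕ) : ℝ)) := lt_of_lt_of_le one_pos (one_le_cast_pow_sub_one hL2 n)
    have hc : (0 : ℝ) < ((P.d - 1 : ℕ) : ℝ) := lt_of_lt_of_le one_pos hD1
    positivity
  have hθ0 : (0 : ℝ) ≤ (P.L : ℝ)⁻¹ := inv_nonneg.2 (by positivity)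
  have hθ8 := inv_L_le_eighth hL8
  have hθ1 : (P.L : ℝ)⁻¹ ≤ 1 := hθ8.trans (by norm_num)
  have hω512 : ωτ + ωu ≤ 1 / 512 := by rw [hωτ]; exact h512
  have hgN' : 65540 * (ωτ + ωu) < deltaSU (Fin N) := by rw [hωτ]; exact hgN
  refine ⟨fun n => 240 * ((((P.d + 2) * P.L : ℕ) : ℝ) * (P.L : ℝ) ^ n * ((((P.d - 1 : ℕ) : ℝ)) * (((P.L ^ (n + 1) - 1 : ℕ) : ℝ)) * a₀)), ωτ, hωτ, hωτ0,
    fun n => le_of_lt (by have := hE2pos n; positivity), hb, hg, fun n _ => ?_, h1, h2, hE, hθ0, hθ8, hω512, ?_, by linarith, fun j i => ?_,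
    fun i hi => ?_, fun i hi => ?_, fun i hi => ?_⟩
  · have h := hE2pos n
    simp only
    linarith
  · have hs0 : 0 ≤ ωτ + ωu := by positivity
    calc 4096 * (P.L : ℝ)⁻¹ * (ωτ + ωu) ≤ 4096 * (1 / 8) * (1 / 512) := by
          apply mul_le_mul (mul_le_mul_of_nonneg_left hθ8 (by norm_num)) hω512 hs0 (by positivity)
      _ = 1 := by norm_num
  · exact lt_of_le_of_lt (guardN_le hθ0 hθ1 hωτ0 hωu hω512 _ _) hgN'
  · exact (twoBlock_bud_le (P := P) (Nat.succ_le_of_lt hi) ha₀.le).trans hbud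
  · exact lt_of_le_of_lt (twoBlock_gd_le (P := P) (Nat.succ_le_of_lt hi) ha₀.le) hgd
  · exact lt_of_le_of_lt (twoBlock_sm_le (P := P) hd1 (Nat.succ_le_of_lt hi) ha₀.le) hsm

/-! ## §3  ✓p760822's `hN` row -/

/-- `L < sitesPerDir n` for every `n < k` as soon as `3 ≤ sitesPerDir k` (`k ≤ m + K`) — ✓p760822's `hN` binder from the knit's no-wrap row (MODULE 137 `two_mul_L_lt_sitesPerDir_of_lt`
gives even `2L < …`). [cite: Balaban1987RG1, (0.1) p.251 (bookkeeping)] -/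
theorem L_lt_sitesPerDir_of_three_le {k : ℕ} (hk : k ≤ P.m + P.K) (h3 : 3 ≤ P.sitesPerDir k) : ∀ n, n < k → P.L < P.sitesPerDir n := by
  intro n hn
  have hL1 : 1 ≤ P.L := P.L_pos
  have hsplit : P.sitesPerDir n = P.L ^ (k - n) * P.sitesPerDir k := by
    rw [Params.sitesPerDir, Params.sitesPerDir, mul_left_comm, ← pow_add]
    congr 2; omega
  have hkn : P.L ≤ P.L ^ (k - n) := by
    calc P.L = P.L ^ 1 := (pow_one _).symm
      _ ≤ P.L ^ (k - n) := Nat.pow_le_pow_right hL1 (by omega)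
  rw [hsplit]
  calc P.L < 3 * P.L := by omega
    _ ≤ P.sitesPerDir k * P.L ^ (k - n) := Nat.mul_le_mul h3 hkn
    _ = P.L ^ (k - n) * P.sitesPerDir k := mul_comm _ _

/-! ## §4  At the record: `L > 11` (`2 ≤ d` is ✓`K0Stub1H128OfRecordCriticalityLetter.two_le_d_T4`, by name) -/

/-- `8 ≤ L` at the record («L is an odd, positive integer > 11», [I] p. 251). [cite: Balaban1987RG1, (0.1) p.251] -/
theorem eight_le_L_record (F : T4Continuum.T4Family) (K : ℕ) : 8 ≤ (F.P K).L := by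
  rw [T4Continuum.T4Family.P_L]; have := F.hL11; omega

/-! ## §5  (v1.1) The guard row in ✓p760822's EXACT shape (ref-G READ627 NIT-1) -/

/-- (v1.1, ref-G READ627 NIT-1.) §2's clause (iii) reads `… + 2·(1024·X)² < δ_N` while ✓p760822's binder `hguardN` reads `… + 2·(1024·X²) < δ_N` (`X = 4(ω_τ+ω_u)θ^{j′−i}`);
the former is STRONGER (`1024·X² ≤ (1024·X)²`), and this is the one-line bridge to the binder's exact shape. [cite: Balaban1987RG1, (0.4) p.253 (bookkeeping)] -/
theorem guardN_shape_of_strong {A X δ : ℝ} (h : A + 2 * (1024 * X) ^ 2 < δ) : A + 2 * (1024 * X ^ 2) < δ := by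
  nlinarith [sq_nonneg X]

/-- (v1.1) ★ **✓p760822's `hguardN` VERBATIM, at every pair of exponents, from §2's clause (iii)** — for consumers that feed `numerics_of_fineLetter` straight into
`torusRow_at_recordCube_cell`: `hguardN := fun i _ => hguardN_of_numerics (hiii j′ i)`. [cite: Balaban1987RG1, (0.4) p.253 (bookkeeping)] -/
theorem hguardN_of_numerics {θ ωτ ωu δ : ℝ} {j i : ℕ}
    (h : 4 * ωτ * θ ^ (j - (i + 1)) + 4 * ωu * θ ^ (j - (i + 1)) + 2 * (1024 * (4 * (ωτ + ωu) * θ ^ (j - i))) ^ 2 < δ) :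
    4 * ωτ * θ ^ (j - (i + 1)) + 4 * ωu * θ ^ (j - (i + 1)) + 2 * (1024 * (4 * (ωτ + ωu) * θ ^ (j - i)) ^ 2) < δ :=
  guardN_shape_of_strong h

/-- (v1.1) The guard row in ✓p760822's exact shape is also implied by the junction's row n15 `4(ω_τ+ω_u) + 32768(ω_τ+ω_u)² < δ_N` (dag-n07-w3's `hnum`, MODULE 139b) for
`0 ≤ θ ≤ 1`, `0 ≤ ω_τ, ω_u` — `2·1024·(4Sθᵇ)² ≤ 32768·S²`. [cite: Balaban1987RG1, (0.4) p.253 (bookkeeping)] -/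
theorem hguardN_of_row15 {θ ωτ ωu δ : ℝ} (hθ0 : 0 ≤ θ) (hθ1 : θ ≤ 1) (hωτ : 0 ≤ ωτ) (hωu : 0 ≤ ωu)
    (h : 4 * (ωτ + ωu) + 32768 * (ωτ + ωu) ^ 2 < δ) (a b : ℕ) :
    4 * ωτ * θ ^ a + 4 * ωu * θ ^ a + 2 * (1024 * (4 * (ωτ + ωu) * θ ^ b) ^ 2) < δ := by
  have ha1 : θ ^ a ≤ 1 := pow_le_one₀ hθ0 hθ1
  have hb1 : θ ^ b ≤ 1 := pow_le_one₀ hθ0 hθ1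
  have ha0 : 0 ≤ θ ^ a := pow_nonneg hθ0 _
  have hb0 : 0 ≤ θ ^ b := pow_nonneg hθ0 _
  have h1 : 4 * ωτ * θ ^ a ≤ 4 * ωτ := by nlinarith
  have h2 : 4 * ωu * θ ^ a ≤ 4 * ωu := by nlinarith
  have h3 : (4 * (ωτ + ωu) * θ ^ b) ^ 2 ≤ (4 * (ωτ + ωu)) ^ 2 := by
    have hx0 : 0 ≤ 4 * (ωτ + ωu) * θ ^ b := by positivity
    have hx : 4 * (ωτ + ωu) * θ ^ b ≤ 4 * (ωτ + ωu) := by nlinarith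
    exact pow_le_pow_left₀ hx0 hx 2
  nlinarith [h3]

end Summit.QuantumFields.YangMills.BalabanUVNodes.N07SymPhiCellNumericsOfFineLetter

end
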